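import Mathlib
import HarnessLib.Audit
import Summits.PneNP.PneNP.Theorems.PstarCrossData

/-!
# The blind free CROSS gate is one VIRTUAL chord: the chord system `vsys` of cross data — infeasible, chord-minimal, constant reads (O2 / E1; prover-1 g22)

FRONTIER range-avoidance ladder, rung F-N3 (`stmt-PneNP-19007`), cell `pnp-ideate`; restricted-model proof complexity — nothing here bears on `P` versus `NP`.

Cross data `B` (`PstarCrossData.CrossData I r B e_p e_q g₀`): in the chord system `sys I B` of the gate-free pair `(R, w₂)` the two chords `e_p, e_q` are
read with the constant vector `(1,0)` through `p = vars e_p 2`, `q = vars e_q 2` and nothing else, and the REAL first constraint is `R + x_p x_q`.  So at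
a base point the pair contributes `x_p + x_q + x_p x_q = x_p ∨ x_q` times `(1,0)`, which over the admissible private states ranges over `{1}` unless
BOTH prescribed products `u_p, u_q` vanish, when it ranges over `{0, 1}`: the pair is ONE chord with prescribed product `u_p ∨ u_q`.

* `ChordSystem.orU`, `ChordSystem.vsys` — for any chord system: the OR `u_p + u_q + u_p u_q` of two prescribed products, and the VIRTUAL SYSTEM in which
  chord `e_p` carries it (everything else unchanged); `vsys` is used on the chord set `N.erase e_q`.
* `realise` — every admissible state of the virtual system at any base point is realised by an assignment solving ALL of `J₀` with the real constraint
  values equal to the virtual ones (lift the base point, impose the states, give both gate privates the virtual bit);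
* `vval_of_solution` / `vadm_of_solution` — conversely an assignment solving the non-chords reads as a virtual state with the real values;
* **`vsys_infeasible`** ((T3) ⟹ the virtual system is infeasible), **`vsys_chordMinimal`** ((M0) ⟹ chord-minimal in every chord of `N.erase e_q`),
  `vsys_const` / `vsys_reads_p` (constant reads; the virtual chord reads `(1,0)` / `0`).
Hence the whole landed model layer (`PstarChordSystem`: R2 pointwise sumset, M-read, M-forced, (★★), `not_killable_pair`, R5) speaks about cross data.
The OR-product on `Z` and the two (M0) witnesses of `e_p`, `e_q` in virtual form are the next file (`PstarCrossRegime`).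
-/

set_option linter.dupNamespace false -- `Summit.PneNP.PneNP.…`: summit = sub-problem name (D-0017 single-conjunct layout)

open Finset Literature.Computability.Complexity
open Summit.PneNP.PneNP.Theorems.PstarFibrePolys (bit bit_xor bit_and bit_injective)
open Summit.PneNP.PneNP.Theorems.PstarTyped (Typed)
open Summit.PneNP.PneNP.Theorems.PstarSALevel (varSet bdry BoundaryExpanding SimpleOverlap)
open Summit.PneNP.PneNP.Theorems.PstarGapOneAll (gval)
open Summit.PneNP.PneNP.Theorems.PstarXCore (xverts)
open Summit.PneNP.PneNP.Theorems.PstarReadSumset (V2)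
open Summit.PneNP.PneNP.Theorems.PstarChordSystem (ChordSystem)
open Summit.PneNP.PneNP.Theorems.PstarChordBridgeTools
open Summit.PneNP.PneNP.Theorems.PstarChordBridge
open Summit.PneNP.PneNP.Theorems.PstarChordBridgeForcing (coef_of_unread const_of_unread)
open Summit.PneNP.PneNP.Theorems.PstarChordReadCoupledSplit (gval_erase_mono)
open Summit.PneNP.PneNP.Theorems.PstarCrossData (CSolution CrossData)

/-! ## The virtual system of an abstract chord system -/

namespace Summit.PneNP.PneNP.Theorems.PstarChordSystem.ChordSystem

variable {ι A : Type*} (S : ChordSystem ι A)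

/-- The OR of the prescribed products of `e_p` and `e_q`: `u_p + u_q + u_p u_q`. -/
def orU (e_p e_q : ι) (a : A) : ZMod 2 := S.u e_p a + S.u e_q a + S.u e_p a * S.u e_q a

/-- The OR-product vanishes iff both products vanish. -/
theorem orU_eq_zero_iff (e_p e_q : ι) (a : A) : S.orU e_p e_q a = 0 ↔ S.u e_p a = 0 ∧ S.u e_q a = 0 := by
  unfold orU
  have h : ∀ x y : ZMod 2, x + y + x * y = 0 ↔ x = 0 ∧ y = 0 := by decide
  exact h _ _

/-- The OR-product is `1` iff one of the products is `1`. -/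
theorem orU_eq_one_iff (e_p e_q : ι) (a : A) : S.orU e_p e_q a = 1 ↔ S.u e_p a = 1 ∨ S.u e_q a = 1 := by
  unfold orU
  have h : ∀ x y : ZMod 2, x + y + x * y = 1 ↔ x = 1 ∨ y = 1 := by decide
  exact h _ _

variable [DecidableEq ι]

/-- **The virtual system**: chord `e_p` carries the OR of the prescribed products of `e_p` and `e_q`; reads, state-free part and target unchanged. -/
def vsys (e_p e_q : ι) : ChordSystem ι A where
  u e a := if e = e_p then S.orU e_p e_q a else S.u e a
  ρ := S.ρ
  ρ' := S.ρ'
  F := S.F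
  t := S.t

variable (e_p e_q : ι)

/-- The virtual product of `e_p`. -/
@[simp] theorem vsys_u_self (a : A) : (S.vsys e_p e_q).u e_p a = S.orU e_p e_q a := if_pos rfl

/-- The other products are unchanged. -/
theorem vsys_u_of_ne {e : ι} (he : e ≠ e_p) (a : A) : (S.vsys e_p e_q).u e a = S.u e a := if_neg he

/-- Reads unchanged. -/
@[simp] theorem vsys_ρ : (S.vsys e_p e_q).ρ = S.ρ := rfl

/-- Reads unchanged. -/
@[simp] theorem vsys_ρ' : (S.vsys e_p e_q).ρ' = S.ρ' := rfl

/-- State-free part unchanged. -/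
@[simp] theorem vsys_F : (S.vsys e_p e_q).F = S.F := rfl

/-- Target unchanged. -/
@[simp] theorem vsys_t : (S.vsys e_p e_q).t = S.t := rfl

/-- Contributions unchanged. -/
@[simp] theorem vsys_contrib : (S.vsys e_p e_q).contrib = S.contrib := rfl

/-- Constraint values unchanged (they do not involve the prescribed products). -/
@[simp] theorem vsys_val (E : Finset ι) (a : A) (s : ι → ZMod 2 × ZMod 2) : (S.vsys e_p e_q).val E a s = S.val E a s := rfl

end Summit.PneNP.PneNP.Theorems.PstarChordSystem.ChordSystem

/-! ## The virtual system of cross data -/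

namespace Summit.PneNP.PneNP.Theorems.PstarCrossSystem

variable {n m : ℕ}

/-- Putting the gate back: `gval(C, G + g₀) = gval(C, G) + x_p x_q`. -/
theorem bit_gval_insert (I : LocalMap 4 n m) (C : Finset (Fin n)) {G : Finset (Fin m)} {g₀ : Fin m} (hg₀ : g₀ ∉ G) (z : Fin n → Bool) :
    bit (gval I C (insert g₀ G) z) = bit (gval I C G z) + bit (z (I.vars g₀ 2)) * bit (z (I.vars g₀ 3)) := by
  classical
  rw [gval_erase_mono I C (insert g₀ G) g₀ z, erase_insert hg₀, decide_eq_true (mem_insert_self g₀ G), Bool.true_and, bit_xor, bit_and]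

section

variable (I : LocalMap 4 n m) {r : ℕ} {B : BridgeData n m} {e_p e_q g₀ : Fin m}

/-- The reads of the two gate chords in `sys I B`: `(1,0)` through `p` (resp. `q`), nothing through the mates. -/
theorem reads_pq (hD : CrossData I r B e_p e_q g₀) (a : Fin n → ZMod 2) :
    (sys I B).ρ e_p a = (1, 0) ∧ (sys I B).ρ' e_p a = 0 ∧ (sys I B).ρ e_q a = (1, 0) ∧ (sys I B).ρ' e_q a = 0 := by
  obtain ⟨hp1, hq1, hp'1, hq'1⟩ := hD.or_shape
  obtain ⟨hp2, hp'2, hq2, hq'2⟩ := hD.blind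
  have hP := hD.hun _ (vars_mem_privs I hD.mem_p (s := 2) (by decide))
  have hP' := hD.hun _ (vars_mem_privs I hD.mem_p (s := 3) (by decide))
  have hQ := hD.hun _ (vars_mem_privs I hD.mem_q (s := 2) (by decide))
  have hQ' := hD.hun _ (vars_mem_privs I hD.mem_q (s := 3) (by decide))
  refine ⟨?_, ?_, ?_, ?_⟩
  · rw [sys_ρ I B hD.mem_p, coef_of_unread I hP.1, coef_of_unread I hP.2, if_pos hp1, if_neg hp2]
  · rw [sys_ρ' I B hD.mem_p, coef_of_unread I hP'.1, coef_of_unread I hP'.2, if_neg hp'1, if_neg hp'2]; rfl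
  · rw [sys_ρ I B hD.mem_q, coef_of_unread I hQ.1, coef_of_unread I hQ.2, if_pos hq1, if_neg hq2]
  · rw [sys_ρ' I B hD.mem_q, coef_of_unread I hQ'.1, coef_of_unread I hQ'.2, if_neg hq'1, if_neg hq'2]; rfl

/-- **All read vectors of the virtual system are constant**, and the virtual chord reads `(1,0)` / `0`. -/
theorem vsys_const (hD : CrossData I r B e_p e_q g₀) :
    ∀ e a a', ((sys I B).vsys e_p e_q).ρ e a = ((sys I B).vsys e_p e_q).ρ e a' ∧
      ((sys I B).vsys e_p e_q).ρ' e a = ((sys I B).vsys e_p e_q).ρ' e a' :=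
  const_of_unread I B hD.hun

/-- The virtual chord reads `(1,0)` in its first private and nothing in its second. -/
theorem vsys_reads_p (hD : CrossData I r B e_p e_q g₀) (a : Fin n → ZMod 2) :
    ((sys I B).vsys e_p e_q).ρ e_p a = (1, 0) ∧ ((sys I B).vsys e_p e_q).ρ' e_p a = 0 :=
  ⟨(reads_pq I hD a).1, (reads_pq I hD a).2.1⟩

/-- **Value split.**  The gate-free value on `N` versus the virtual value on `N.erase e_q`, for states that agree off `e_p, e_q`: they differ by the first
bits of `e_p, e_q` (real) and of `e_p` (virtual), in the first coordinate only. -/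
theorem val_split (hD : CrossData I r B e_p e_q g₀) (a : Fin n → ZMod 2) (s σ : Fin m → ZMod 2 × ZMod 2)
    (hs : ∀ e ∈ B.N, e ≠ e_p → e ≠ e_q → σ e = s e) :
    (sys I B).val B.N a σ = ((sys I B).vsys e_p e_q).val (B.N.erase e_q) a s + ((σ e_p).1 + (σ e_q).1 + (s e_p).1, 0) := by
  obtain ⟨hρp, hρp', hρq, hρq'⟩ := reads_pq I hD a
  have hpe : e_p ∈ B.N.erase e_q := mem_erase.2 ⟨hD.ne, hD.mem_p⟩
  rw [(sys I B).val_eq hD.mem_q, (sys I B).val_eq hpe, ChordSystem.vsys_val, (sys I B).val_eq hpe]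
  have hrest : (sys I B).val ((B.N.erase e_q).erase e_p) a σ = (sys I B).val ((B.N.erase e_q).erase e_p) a s := by
    unfold ChordSystem.val
    congr 1
    refine sum_congr rfl fun e he => ?_
    unfold ChordSystem.contrib
    rw [hs e (mem_of_mem_erase (mem_of_mem_erase he)) (ne_of_mem_erase he) (ne_of_mem_erase (mem_of_mem_erase he))]
  have hcp : ∀ x : Fin m → ZMod 2 × ZMod 2, (sys I B).contrib a x e_p = ((x e_p).1, 0) := fun x => by
    unfold ChordSystem.contrib; rw [hρp, hρp', smul_zero, add_zero]; ext <;> simp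
  have hcq : ∀ x : Fin m → ZMod 2 × ZMod 2, (sys I B).contrib a x e_q = ((x e_q).1, 0) := fun x => by
    unfold ChordSystem.contrib; rw [hρq, hρq', smul_zero, add_zero]; ext <;> simp
  rw [hrest, hcp, hcp, hcq]
  have h2 : ∀ a b c d : ZMod 2, a + (b + d) = c + d + (b + a + c) := by decide
  ext <;> simp only [Prod.fst_add, Prod.snd_add, add_zero, zero_add]
  exact h2 _ _ _ _

/-- **Realisation.**  Every admissible state of the virtual system on `N.erase e_q`, at any base point, is realised by an assignment solving ALL outputs of
`J₀` whose real constraint values (gate included) are the virtual values and whose gate privates both carry the virtual bit. -/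
theorem realise (hI : I.IsPure xorAndPred) (hT : Typed I) (hD : CrossData I r B e_p e_q g₀) (x₀ : Fin n → ZMod 2) (s : Fin m → ZMod 2 × ZMod 2)
    (hadm : ((sys I B).vsys e_p e_q).Adm (B.N.erase e_q) x₀ s) :
    ∃ z : Fin n → Bool, (∀ j ∈ B.J₀, I.eval z j = B.y j) ∧
      bit (gval I B.C₁ (insert g₀ B.G₁) z) = (((sys I B).vsys e_p e_q).val (B.N.erase e_q) x₀ s).1 ∧
      bit (gval I B.C₂ B.G₂ z) = (((sys I B).vsys e_p e_q).val (B.N.erase e_q) x₀ s).2 ∧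
      bit (z (I.vars e_p 2)) = (s e_p).1 ∧ bit (z (I.vars e_q 2)) = (s e_p).1 := by
  classical
  have hW := hD.wf
  set S := sys I B with hSdef
  -- the real states
  let σ : Fin m → ZMod 2 × ZMod 2 := fun e =>
    if e = e_p then ((s e_p).1, S.u e_p x₀ * (s e_p).1) else if e = e_q then ((s e_p).1, S.u e_q x₀ * (s e_p).1) else s e
  have hσp : σ e_p = ((s e_p).1, S.u e_p x₀ * (s e_p).1) := if_pos rfl
  have hσq : σ e_q = ((s e_p).1, S.u e_q x₀ * (s e_p).1) := by
    show (if e_q = e_p then _ else _) = _; rw [if_neg hD.ne.symm, if_pos rfl]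
  have hσo : ∀ e, e ≠ e_p → e ≠ e_q → σ e = s e := fun e h1 h2 => by
    show (if e = e_p then _ else _) = _; rw [if_neg h1, if_neg h2]
  -- admissibility of the virtual bit: `b = 0` forces both products to vanish
  have hb0 : (s e_p).1 = 0 → S.u e_p x₀ = 0 ∧ S.u e_q x₀ = 0 := by
    intro hb
    have h := hadm e_p (mem_erase.2 ⟨hD.ne, hD.mem_p⟩)
    rw [ChordSystem.vsys_u_self, hb, zero_mul] at h
    exact (S.orU_eq_zero_iff e_p e_q x₀).1 h.symm
  have hcases : (s e_p).1 = 0 ∨ (s e_p).1 = 1 := (by decide : ∀ t : ZMod 2, t = 0 ∨ t = 1) _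
  have hadm_p : (s e_p).1 * (S.u e_p x₀ * (s e_p).1) = S.u e_p x₀ := by
    rcases hcases with hb | hb
    · rw [(hb0 hb).1, hb, zero_mul]
    · rw [hb, mul_one, one_mul]
  have hadm_q : (s e_p).1 * (S.u e_q x₀ * (s e_p).1) = S.u e_q x₀ := by
    rcases hcases with hb | hb
    · rw [(hb0 hb).2, hb, zero_mul]
    · rw [hb, mul_one, one_mul]
  have hσadm : S.Adm B.N x₀ σ := by
    intro e he
    by_cases hep : e = e_p
    · subst hep; rw [hσp]; exact hadm_p
    by_cases heq : e = e_q
    · subst heq; rw [hσq]; exact hadm_q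
    · rw [hσo e hep heq, ← S.vsys_u_of_ne e_p e_q hep]
      exact hadm e (mem_erase.2 ⟨heq, he⟩)
  -- lift the base point, then impose the real states on the privates
  obtain ⟨z₁, hz₁, hz₁x⟩ := hD.lift fun v => toBool (x₀ v)
  let sB : Fin m → Bool × Bool := fun e => (toBool (σ e).1, toBool (σ e).2)
  let z : Fin n → Bool := setPriv I B.N sB z₁
  have hzF : ∀ j ∈ B.J₀ \ B.N, I.eval z j = B.y j := fun j hj => by
    rw [eval_setPriv_of_mem_sdiff I hW.hN hW.hchord sB z₁ hj]; exact hz₁ j hj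
  have hagree : ∀ v, v ∉ xverts I (B.J₀ \ B.N) → v ∉ privs I B.N → x₀ v = bit (z v) := by
    intro v hvx hvp
    show x₀ v = bit (setPriv I B.N sB z₁ v)
    rw [setPriv_of_not_mem I sB z₁ hvp, hz₁x v hvx, bit_toBool]
  have hs2 : ∀ e ∈ B.N, bit (z (I.vars e 2)) = (σ e).1 := fun e he => by
    show bit (setPriv I B.N sB z₁ (I.vars e 2)) = _
    rw [setPriv_two I hW.hN hW.hchord sB z₁ he]; exact bit_toBool _
  have hs3 : ∀ e ∈ B.N, bit (z (I.vars e 3)) = (σ e).2 := fun e he => by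
    show bit (setPriv I B.N sB z₁ (I.vars e 3)) = _
    rw [setPriv_three I hI hW.hN hW.hchord sB z₁ he]; exact bit_toBool _
  have hval' : S.val B.N (fun v => bit (z v)) (fun e => (bit (z (I.vars e 2)), bit (z (I.vars e 3)))) = S.val B.N x₀ σ := by
    rw [hSdef, val_sys, val_sys, free_congr I hT hW hW.hT₁ B.C₁ B.G₁ hagree, free_congr I hT hW hW.hT₂ B.C₂ B.G₂ hagree]
    refine Prod.ext ?_ ?_
    · simp only
      congr 1
      refine sum_congr rfl fun e he => ?_
      rw [hs2 e he, hs3 e he, coef_congr I hT hW.hcross₁ (vars_mem_privs I he (s := 2) (by decide)) _ hagree,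
        coef_congr I hT hW.hcross₁ (vars_mem_privs I he (s := 3) (by decide)) _ hagree]
    · simp only
      congr 1
      refine sum_congr rfl fun e he => ?_
      rw [hs2 e he, hs3 e he, coef_congr I hT hW.hcross₂ (vars_mem_privs I he (s := 2) (by decide)) _ hagree,
        coef_congr I hT hW.hcross₂ (vars_mem_privs I he (s := 3) (by decide)) _ hagree]
  -- `z` solves every output of `J₀`
  have hzJ : ∀ j ∈ B.J₀, I.eval z j = B.y j := by
    intro j hj
    by_cases hjN : j ∈ B.N
    · rw [eval_iff_adm I hI hW hzF hjN, hs2 j hjN, hs3 j hjN, hσadm j hjN, hSdef, sys_u, sys_u]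
      exact uval_congr I hT hW hjN hagree
    · exact hzF j (mem_sdiff.2 ⟨hj, hjN⟩)
  -- the gate-free values
  have hvz := val_of_solution I hI hT hW hzF
  rw [← hSdef, hval', val_split I hD x₀ s σ (fun e _ h1 h2 => hσo e h1 h2), hσp, hσq] at hvz
  have h1 := congrArg Prod.fst hvz
  have h2 := congrArg Prod.snd hvz
  simp only [Prod.fst_add, Prod.snd_add, add_zero] at h1 h2
  refine ⟨z, hzJ, ?_, h2.symm, by rw [hs2 _ hD.mem_p, hσp], by rw [hs2 _ hD.mem_q, hσq]⟩
  rw [bit_gval_insert I B.C₁ hD.gate_nmem z, hD.gate_vars.1, hD.gate_vars.2, hs2 _ hD.mem_p, hs2 _ hD.mem_q, hσp, hσq]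
  have hbb : ∀ t u v : ZMod 2, u + (t + t + t) = v → v + t * t = u := by decide
  simpa using hbb _ _ _ h1

/-! ## From assignments to virtual states -/

/-- The virtual states read off an assignment: the real private bits, except that the virtual chord carries `(x_p ∨ x_q, u_p ∨ u_q)`. -/
def vstate (B : BridgeData n m) (e_p e_q : Fin m) (z : Fin n → Bool) : Fin m → ZMod 2 × ZMod 2 := fun e =>
  if e = e_p then (bit (z (I.vars e_p 2) || z (I.vars e_q 2)), (sys I B).orU e_p e_q fun v => bit (z v))
  else (bit (z (I.vars e 2)), bit (z (I.vars e 3)))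

/-- The virtual state of the virtual chord. -/
theorem vstate_self (z : Fin n → Bool) :
    vstate I B e_p e_q z e_p = (bit (z (I.vars e_p 2) || z (I.vars e_q 2)), (sys I B).orU e_p e_q fun v => bit (z v)) := if_pos rfl

/-- The virtual states of the other chords are the real ones. -/
theorem vstate_of_ne {e : Fin m} (he : e ≠ e_p) (z : Fin n → Bool) : vstate I B e_p e_q z e = (bit (z (I.vars e 2)), bit (z (I.vars e 3))) :=
  if_neg he

/-- **An assignment solving the non-chords reads as a virtual state with the REAL constraint values** (gate included). -/
theorem vval_of_solution (hI : I.IsPure xorAndPred) (hT : Typed I) (hD : CrossData I r B e_p e_q g₀) {z : Fin n → Bool}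
    (hz : ∀ j ∈ B.J₀ \ B.N, I.eval z j = B.y j) :
    ((sys I B).vsys e_p e_q).val (B.N.erase e_q) (fun v => bit (z v)) (vstate I B e_p e_q z) =
      (bit (gval I B.C₁ (insert g₀ B.G₁) z), bit (gval I B.C₂ B.G₂ z)) := by
  have hv := val_of_solution I hI hT hD.wf hz
  rw [val_split I hD _ (vstate I B e_p e_q z) _ (fun e _ h1 _ => (vstate_of_ne I h1 z).symm), vstate_self] at hv
  rw [bit_gval_insert I B.C₁ hD.gate_nmem z, hD.gate_vars.1, hD.gate_vars.2]
  have e3 : ∀ a b : Bool, bit (a || b) = bit a + bit b + bit a * bit b := by decide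
  rw [e3] at hv
  have h1 := congrArg Prod.fst hv
  have h2 := congrArg Prod.snd hv
  simp only [Prod.fst_add, Prod.snd_add, add_zero] at h1 h2
  refine Prod.ext ?_ h2
  simp only
  rw [← h1]
  have hbb : ∀ v a b : ZMod 2, v + (a + b + (a + b + a * b)) + a * b = v := by decide
  exact (hbb _ _ _).symm

/-- A real chord other than the virtual one that holds at `z` is virtually admissible. -/
theorem vadm_of_ne (hI : I.IsPure xorAndPred) (hD : CrossData I r B e_p e_q g₀) {z : Fin n → Bool}
    (hz : ∀ j ∈ B.J₀ \ B.N, I.eval z j = B.y j) {e : Fin m} (he : e ∈ B.N) (hep : e ≠ e_p) (hze : I.eval z e = B.y e) :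
    (vstate I B e_p e_q z e).1 * (vstate I B e_p e_q z e).2 = ((sys I B).vsys e_p e_q).u e fun v => bit (z v) := by
  rw [vstate_of_ne I hep, ChordSystem.vsys_u_of_ne _ _ _ hep]
  exact (eval_iff_adm I hI hD.wf hz he).1 hze

/-- If both gate chords hold at `z`, the virtual chord is virtually admissible. -/
theorem vadm_self (hI : I.IsPure xorAndPred) (hD : CrossData I r B e_p e_q g₀) {z : Fin n → Bool}
    (hz : ∀ j ∈ B.J₀ \ B.N, I.eval z j = B.y j) (hzp : I.eval z e_p = B.y e_p) (hzq : I.eval z e_q = B.y e_q) :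
    (vstate I B e_p e_q z e_p).1 * (vstate I B e_p e_q z e_p).2 = ((sys I B).vsys e_p e_q).u e_p fun v => bit (z v) := by
  rw [vstate_self, ChordSystem.vsys_u_self]
  set x : Fin n → ZMod 2 := fun v => bit (z v)
  rcases (by decide : ∀ t : ZMod 2, t = 0 ∨ t = 1) ((sys I B).orU e_p e_q x) with h0 | h1
  · simp only [h0, mul_zero]
  · simp only [h1, mul_one]
    have hp := (eval_iff_adm I hI hD.wf hz hD.mem_p).1 hzp
    have hq := (eval_iff_adm I hI hD.wf hz hD.mem_q).1 hzq
    rcases ((sys I B).orU_eq_one_iff e_p e_q x).1 h1 with hu | hu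
    · rw [← hp] at hu
      have : z (I.vars e_p 2) = true := by
        revert hu; cases z (I.vars e_p 2) <;> simp [bit]
      rw [this, Bool.true_or]; rfl
    · rw [← hq] at hu
      have : z (I.vars e_q 2) = true := by
        revert hu; cases z (I.vars e_q 2) <;> simp [bit]
      rw [this, Bool.or_true]; rfl

/-! ## The virtual system is infeasible and chord-minimal -/

/-- **(T3) ⟹ the virtual system is infeasible.** -/
theorem vsys_infeasible (hI : I.IsPure xorAndPred) (hT : Typed I) (hD : CrossData I r B e_p e_q g₀) :
    ((sys I B).vsys e_p e_q).Infeasible (B.N.erase e_q) := by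
  intro x₀ s hadm hval
  obtain ⟨z, hzJ, h1, h2, -, -⟩ := realise I hI hT hD x₀ s hadm
  rw [hval] at h1 h2
  exact hD.T3 ⟨z, hzJ, bit_injective (by rw [h1]; rfl), bit_injective (by rw [h2]; rfl)⟩

/-- **(M0) ⟹ the virtual system is chord-minimal in every chord of `N.erase e_q`.** -/
theorem vsys_chordMinimal (hI : I.IsPure xorAndPred) (hT : Typed I) (hD : CrossData I r B e_p e_q g₀) {e : Fin m} (he : e ∈ B.N.erase e_q) :
    ((sys I B).vsys e_p e_q).ChordMinimal (B.N.erase e_q) e := by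
  obtain ⟨z, hzK, hz1, hz2⟩ := hD.M0 e (hD.wf.hN (mem_of_mem_erase he))
  have heN : e ∈ B.N := mem_of_mem_erase he
  have hz : ∀ j ∈ B.J₀ \ B.N, I.eval z j = B.y j := fun j hj =>
    hzK j (mem_erase.2 ⟨fun h => (mem_sdiff.1 hj).2 (h ▸ heN), (mem_sdiff.1 hj).1⟩)
  have hsol : ∀ e' ∈ B.N, e' ≠ e → I.eval z e' = B.y e' := fun e' he' hne => hzK e' (mem_erase.2 ⟨hne, hD.wf.hN he'⟩)
  refine ⟨fun v => bit (z v), vstate I B e_p e_q z, fun e' he' => ?_, ?_⟩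
  · have he'N : e' ∈ B.N := mem_of_mem_erase (mem_of_mem_erase he')
    have hne : e' ≠ e := ne_of_mem_erase he'
    by_cases hep : e' = e_p
    · subst hep
      exact vadm_self I hI hD hz (hsol _ hD.mem_p hne) (hsol _ hD.mem_q (ne_of_mem_erase he).symm)
    · exact vadm_of_ne I hI hD hz he'N hep (hsol e' he'N hne)
  · rw [vval_of_solution I hI hT hD hz, hz1, hz2]; rfl

end

end Summit.PneNP.PneNP.Theorems.PstarCrossSystem
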